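import Summits.KontsevichZagierPeriods.KontsevichZagierPeriods.Theses.ComplexOrientations
import Summits.KontsevichZagierPeriods.KontsevichZagierPeriods.Theorems.ComplexOrientationsOvalSectorDiscSector
import Summits.KontsevichZagierPeriods.KontsevichZagierPeriods.Theorems.ComplexOrientationsOvalSectorTranslateDisc
import Literature.NumberTheory.Transcendental.KZLogCalculusProofs

/-!
# `OvalSector` (crux stmt-KontsevichZagierPeriods-11369), line `birth` — dividing lattice and the composite certificate

Route `KontsevichZagierPeriods/ComplexOrientations`, crux `OvalSector` (Kontsevich–Zagier's
Conjecture 1 on the integer oval sector of one compact real-smooth plane curve over `ℚ`). Two pieces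
of the registered skeleton `Lines/birth.lean`:

* `stub_dividingLattice` (registered stub) — **the forced identities of a dividing curve, from the
  route item `TypeOneIdentities`** (the crux's declared dependency, hypothesis BY NAME): for `p`
  complex-smooth, geometrically irreducible and dividing, every identity whose coefficient vector is
  `m·η` (`η` unit signs, `m ∈ ℕ`) is `m` times the unit-sign identity against the disc of radius²
  `β/m` plus the disc bookkeeping `m·[disc β/m] ~ [disc β]` (`stub_discMultiple`), the value of the
  unit-sign identity being read off the SOUNDNESS of the calculus;
* the CERTIFICATE that the registered stub `stub_composite` (curves NOT both complex-smooth and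
  geometrically irreducible), read as a closed statement, is EQUIVALENT to the whole crux
  (`OvalSector_of_compositeSector`, `compositeSector_of_OvalSector`): the crux sees `p` only through
  its real zero set and real smoothness, both unchanged under `p ↦ p·(1 + x² + y²)`, while the twist
  is never geometrically irreducible (`1 + x² + y²` vanishes at `(i, 0)`, `p` at a real point of an
  oval). So the cut of `Lines/birth.lean` along the complex class of `p` is not a reduction of the
  crux: `stub_composite` must be promoted / the crux re-lined by REAL geometry.

References: M. Kontsevich, D. Zagier, *Periods* (2001), §1.2 rules (1), (2), Conjecture 1;
V. A. Rokhlin, *Complex orientations of real algebraic curves* (1974);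
J. Bochnak, M. Coste, M.-F. Roy, *Real Algebraic Geometry* (1998), §2.
-/

noncomputable section

open Set MeasureTheory MvPolynomial
open Literature.NumberTheory.Transcendental Literature.ModelTheory.ExponentialFields
open Summit.KontsevichZagierPeriods.KontsevichZagierPeriods.Theses.ComplexOrientations

namespace Summit.KontsevichZagierPeriods.ComplexOrientations.OvalSector

/-! ### The forced identities of a dividing curve (from the route item `TypeOneIdentities`) -/

/-- Value bookkeeping through SOUNDNESS of the calculus: if `m·[e₁] − [e] ∈ relations` then
`m · value(e₁) = value(e)`. [cite: KontsevichZagier2001, §1.2] -/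
theorem natCast_mul_value_eq_of_nsmul_sub_mem_relations {d : ℕ} (m : ℕ) (e₁ e : KZ.IntegralRep d)
    (h : m • KZ.of e₁ - KZ.of e ∈ KZ.relations) : (m : ℝ) * e₁.value = e.value := by
  have h' := KZ.relations_le_ker_eval_holds h
  rw [AddMonoidHom.mem_ker, map_sub, map_nsmul, KZ.eval_of, KZ.eval_of, nsmul_eq_mul,
    sub_eq_zero] at h'
  exact h'

/-- **Stub `stub_dividingLattice`: dividing curves, lattice of the unit-sign identities** (CONDITIONAL on the route item
`TypeOneIdentities`, stmt-KontsevichZagierPeriods-11368, taken by name). For `p ∈ ℚ[x,y]` with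
compact real zero locus, complex-smooth, geometrically irreducible and dividing, ovals `Oᵢ` with
interior representations `sᵢ`, and an identity `Σ nᵢ·Area(Rᵢ) = Area(disc β)` whose coefficient
vector is `n = m·η` with `η ∈ {±1}ᵏ`, `m ∈ ℕ`: `Σ nᵢ[sᵢ] − [e] ∈ KZ.relations`. Chain: `m = 0` is a
null disc; else restrict `e` to the disc of radius² `β/m`, get `m·[disc β/m] ~ [disc β]` from
`stub_discMultiple`, read `Σ ηᵢ·Area(Rᵢ) = Area(disc β/m)` off soundness, apply `TypeOneIdentities`,
and reassemble `Σ nᵢ[sᵢ] − [e] = m·(Σ ηᵢ[sᵢ] − [e₁]) + (m·[e₁] − [e])`.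
[cite: KontsevichZagier2001, §1.2 Conjecture 1] [cite: Rokhlin1974] -/
theorem stub_dividingLattice (hT : TypeOneIdentities)
    (p : MvPolynomial (Fin 2) ℚ)
    (hZ : IsCompact {v : Fin 2 → ℝ | MvPolynomial.aeval v p = 0})
    (hcs : ∀ w : Fin 2 → ℂ, MvPolynomial.aeval w p = 0 →
      ∃ i, MvPolynomial.aeval w (MvPolynomial.pderiv i p) ≠ 0)
    (hirr : Irreducible (MvPolynomial.map (algebraMap ℚ ℂ) p))
    (hdiv : ¬ IsPreconnected {w : Fin 2 → ℂ | MvPolynomial.aeval w p = 0 ∧ ∃ i, (w i).im ≠ 0})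
    (k : ℕ) (O : Fin k → Set (Fin 2 → ℝ)) (s : Fin k → KZ.IntegralRep 2)
    (hO : ∀ i, ∃ v : Fin 2 → ℝ, MvPolynomial.aeval v p = 0 ∧
      O i = connectedComponentIn {u : Fin 2 → ℝ | MvPolynomial.aeval u p = 0} v)
    (hOinj : Function.Injective O)
    (hOcov : ∀ v : Fin 2 → ℝ, MvPolynomial.aeval v p = 0 → ∃ i, v ∈ O i)
    (hsdom : ∀ i, (s i).domain =
      {v : Fin 2 → ℝ | v ∉ O i ∧ Bornology.IsBounded (connectedComponentIn (O i)ᶜ v)})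
    (hsint : ∀ i, ∀ v ∈ (s i).domain, (s i).integrand v = 1)
    (m : ℕ) (η : Fin k → ℤ) (hη : ∀ i, η i = 1 ∨ η i = -1)
    (β : ℝ) (e : KZ.IntegralRep 2) (hβ : IsAlgebraic ℚ β) (hβ0 : 0 ≤ β)
    (hedom : e.domain = {v : Fin 2 → ℝ | v 0 ^ 2 + v 1 ^ 2 < β})
    (heint : ∀ v ∈ e.domain, e.integrand v = 1)
    (hval : ∑ i, ((m : ℤ) * η i : ℝ) * (s i).value = e.value) :
    (∑ i, ((m : ℤ) * η i) • KZ.of (s i)) - KZ.of e ∈ KZ.relations := by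
  rcases Nat.eq_zero_or_pos m with rfl | hmpos'
  · -- `m = 0`: the identity is `0 = Area(e)`, the disc is null
    have hv : e.value = 0 := by simpa using hval.symm
    have hmeas : MeasurableSet e.domain := KZ.IntegralRep.measurableSet_domain_holds e
    have hint : IntegrableOn (fun _ => (1 : ℝ)) e.domain := e.integrableOn.congr_fun heint hmeas
    have hfin : volume e.domain < ⊤ := by
      rcases (integrableOn_const_iff (C := (1 : ℝ))).1 hint with h | h
      · simp at h
      · exact h
    have hval' : e.value = (volume e.domain).toReal := by
      show ∫ x in e.domain, e.integrand x = (volume e.domain).toReal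
      rw [setIntegral_congr_fun hmeas heint, setIntegral_const, smul_eq_mul, mul_one]
      rfl
    have he : KZ.of e ∈ KZ.relations := by
      apply KZ.of_mem_relations_of_volume_eq_zero
      have h : (volume e.domain).toReal = 0 := hval' ▸ hv
      rcases ENNReal.toReal_eq_zero_iff _ |>.1 h with h' | h'
      · exact h'
      · exact absurd h' hfin.ne
    simpa using KZ.relations.neg_mem he
  have hm0 : m ≠ 0 := Nat.pos_iff_ne_zero.mp hmpos'
  have hmpos : (0 : ℝ) < m := by exact_mod_cast hmpos'
  -- the disc of radius² `β / m`, as a restriction of `e`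
  have hβ₁alg : IsAlgebraic ℚ (β / m) := by
    have hq : IsAlgebraic ℚ ((m : ℝ)⁻¹) := by
      have : ((m : ℝ)⁻¹) = algebraMap ℚ ℝ ((m : ℚ)⁻¹) := by simp
      rw [this]
      exact isAlgebraic_algebraMap _
    simpa [div_eq_mul_inv] using hβ.mul hq
  have hβ₁0 : 0 ≤ β / m := div_nonneg hβ0 hmpos.le
  have hβ₁le : β / m ≤ β := div_le_self hβ0 (by exact_mod_cast Nat.one_le_iff_ne_zero.mpr hm0)
  have hsub : {v : Fin 2 → ℝ | v 0 ^ 2 + v 1 ^ 2 < β / m} ⊆ e.domain := by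
    rw [hedom]
    intro v hv
    simp only [mem_setOf_eq] at hv ⊢
    exact lt_of_lt_of_le hv hβ₁le
  set e₁ : KZ.IntegralRep 2 :=
    e.restrict {v : Fin 2 → ℝ | v 0 ^ 2 + v 1 ^ 2 < β / m} (isSemialgebraic_centredDisc_translateDisc hβ₁alg)
      hsub with he₁
  have he₁dom : e₁.domain = {v : Fin 2 → ℝ | v 0 ^ 2 + v 1 ^ 2 < β / m} := rfl
  have he₁int : ∀ v ∈ e₁.domain, e₁.integrand v = 1 := fun v hv => heint v (hsub hv)
  -- disc bookkeeping: `m·[e₁] − [e] ∈ relations`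
  have hmβ : (m : ℝ) * (β / m) = β := by field_simp
  have hdisc : m • KZ.of e₁ - KZ.of e ∈ KZ.relations :=
    stub_discMultiple m (β / m) hβ₁alg hβ₁0 e₁ e he₁dom he₁int (by rw [hedom, hmβ]) heint
  -- values: `m · Area(e₁) = Area(e)`, hence the unit-sign identity holds in value
  have hval₁ : (m : ℝ) * e₁.value = e.value :=
    natCast_mul_value_eq_of_nsmul_sub_mem_relations m e₁ e hdisc
  have hvalη : ∑ i, (η i : ℝ) * (s i).value = e₁.value := by
    have h : (m : ℝ) * ∑ i, (η i : ℝ) * (s i).value = (m : ℝ) * e₁.value := by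
      rw [hval₁, ← hval, Finset.mul_sum]
      refine Finset.sum_congr rfl fun i _ => ?_
      push_cast
      ring
    exact mul_left_cancel₀ hmpos.ne' h
  -- the unit-sign identity is a chain (TypeOneIdentities)
  have hTI : (∑ i, η i • KZ.of (s i)) - KZ.of e₁ ∈ KZ.relations :=
    hT p hZ hcs hirr hdiv k O s hO hOinj hOcov hsdom hsint η (β / m) e₁ hη hβ₁alg hβ₁0 he₁dom
      he₁int hvalη
  -- assemble: `Σ nᵢ[sᵢ] − [e] = m·(Σ ηᵢ[sᵢ] − [e₁]) + (m·[e₁] − [e])`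
  have hA : (∑ i, ((m : ℤ) * η i) • KZ.of (s i)) = m • ∑ i, η i • KZ.of (s i) := by
    rw [Finset.smul_sum]
    refine Finset.sum_congr rfl fun i _ => ?_
    rw [mul_smul, natCast_zsmul]
  have hB : m • (∑ i, η i • KZ.of (s i)) - KZ.of e =
      m • ((∑ i, η i • KZ.of (s i)) - KZ.of e₁) + (m • KZ.of e₁ - KZ.of e) := by
    rw [smul_sub]
    abel
  rw [hA, hB]
  exact KZ.relations.add_mem (KZ.relations.nsmul_mem hTI m) hdisc

/-! ### The composite stub is crux-equivalent (certificate) -/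

/-- An integral representation whose integrand is `1` on its domain and whose value is `0` is a
relation (its domain is null). [cite: KontsevichZagier2001, §1.2 rule (1)] -/
private theorem of_mem_relations_of_one_of_value_zero {d : ℕ} (r : KZ.IntegralRep d)
    (h1 : ∀ v ∈ r.domain, r.integrand v = 1) (h0 : r.value = 0) :
    KZ.of r ∈ KZ.relations := by
  have hmeas : MeasurableSet r.domain := KZ.IntegralRep.measurableSet_domain_holds r
  have hint : IntegrableOn (fun _ => (1 : ℝ)) r.domain := r.integrableOn.congr_fun h1 hmeas
  have hfin : volume r.domain < ⊤ := by
    rcases (integrableOn_const_iff (C := (1 : ℝ))).1 hint with h | h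
    · simp at h
    · exact h
  have hval : r.value = (volume r.domain).toReal := by
    show ∫ x in r.domain, r.integrand x = (volume r.domain).toReal
    rw [setIntegral_congr_fun hmeas h1, setIntegral_const, smul_eq_mul, mul_one]
    rfl
  apply KZ.of_mem_relations_of_volume_eq_zero
  have h : (volume r.domain).toReal = 0 := hval ▸ h0
  rcases ENNReal.toReal_eq_zero_iff _ |>.1 h with h' | h'
  · exact h'
  · exact absurd h' hfin.ne

/-- **The composite stub implies the crux.** If the conclusion of `OvalSector` holds for every
admissible `p` that is NOT both complex-smooth and geometrically irreducible (and every `n ≠ 0`) —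
verbatim the registered stub `stub_composite` of `Lines/birth.lean`, universally closed — then
`OvalSector` holds outright: `n = 0` is a null disc, and for `n ≠ 0` one applies the hypothesis to
`p·(1 + x² + y²)`, which has the same real zero set, the same ovals and interiors and the same real
smoothness as `p`, and is reducible over `ℂ` (neither factor is a unit: `p` vanishes at a real point
of an oval, `1 + x² + y²` at `(i, 0)`). [cite: KontsevichZagier2001, §1.2 Conjecture 1] -/
theorem OvalSector_of_compositeSector
    (hC : ∀ (p : MvPolynomial (Fin 2) ℚ), IsCompact {v : Fin 2 → ℝ | MvPolynomial.aeval v p = 0} →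
      (∀ v : Fin 2 → ℝ, MvPolynomial.aeval v p = 0 →
        ∃ i, MvPolynomial.aeval v (MvPolynomial.pderiv i p) ≠ 0) →
      ¬ ((∀ w : Fin 2 → ℂ, MvPolynomial.aeval w p = 0 →
          ∃ i, MvPolynomial.aeval w (MvPolynomial.pderiv i p) ≠ 0) ∧
        Irreducible (MvPolynomial.map (algebraMap ℚ ℂ) p)) →
      ∀ (k : ℕ) (O : Fin k → Set (Fin 2 → ℝ)) (s : Fin k → KZ.IntegralRep 2),
      (∀ i, ∃ v : Fin 2 → ℝ, MvPolynomial.aeval v p = 0 ∧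
        O i = connectedComponentIn {u : Fin 2 → ℝ | MvPolynomial.aeval u p = 0} v) →
      Function.Injective O →
      (∀ v : Fin 2 → ℝ, MvPolynomial.aeval v p = 0 → ∃ i, v ∈ O i) →
      (∀ i, (s i).domain =
        {v : Fin 2 → ℝ | v ∉ O i ∧ Bornology.IsBounded (connectedComponentIn (O i)ᶜ v)}) →
      (∀ i, ∀ v ∈ (s i).domain, (s i).integrand v = 1) →
      ∀ (n : Fin k → ℤ), n ≠ 0 → ∀ (β : ℝ) (e : KZ.IntegralRep 2), IsAlgebraic ℚ β → 0 ≤ β →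
      e.domain = {v : Fin 2 → ℝ | v 0 ^ 2 + v 1 ^ 2 < β} →
      (∀ v ∈ e.domain, e.integrand v = 1) →
      ∑ i, (n i : ℝ) * (s i).value = e.value →
      (∑ i, n i • KZ.of (s i)) - KZ.of e ∈ KZ.relations) :
    OvalSector := by
  intro p hZ hsm k O s hO hOinj hOcov hsdom hsint n β e hβ hβ0 hedom heint hval
  -- (0) the zero identity: `Area(e) = 0`, so the disc is null and `[e]` is a relation
  by_cases hn0 : n = 0
  · subst hn0
    have hv : e.value = 0 := by simpa using hval.symm
    simpa using KZ.relations.neg_mem (of_mem_relations_of_one_of_value_zero e heint hv)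
  -- (1) the twist `p' = p · (1 + x² + y²)`
  set q : MvPolynomial (Fin 2) ℚ := 1 + X 0 ^ 2 + X 1 ^ 2 with hq
  have hqpos : ∀ v : Fin 2 → ℝ, 0 < MvPolynomial.aeval v q := fun v => by
    simp only [hq, map_add, map_one, map_pow, aeval_X]
    positivity
  have hzero : ∀ v : Fin 2 → ℝ, MvPolynomial.aeval v (p * q) = 0 ↔ MvPolynomial.aeval v p = 0 :=
    fun v => by rw [map_mul, mul_eq_zero, or_iff_left (hqpos v).ne']
  have hZeq : {v : Fin 2 → ℝ | MvPolynomial.aeval v (p * q) = 0} =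
      {v : Fin 2 → ℝ | MvPolynomial.aeval v p = 0} := by
    ext v
    exact hzero v
  -- real smoothness is preserved (`∂ᵢ(pq) = q ∂ᵢp` on `Z(p)`, `q > 0`)
  have hsm' : ∀ v : Fin 2 → ℝ, MvPolynomial.aeval v (p * q) = 0 →
      ∃ i, MvPolynomial.aeval v (MvPolynomial.pderiv i (p * q)) ≠ 0 := by
    intro v hv
    have hv0 : MvPolynomial.aeval v p = 0 := (hzero v).mp hv
    obtain ⟨i, hi⟩ := hsm v hv0
    refine ⟨i, ?_⟩
    rw [pderiv_mul, map_add, map_mul, map_mul, hv0, zero_mul, add_zero]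
    exact mul_ne_zero hi (hqpos v).ne'
  -- the twist is reducible over `ℂ`
  have hk : 0 < k := by
    rcases Nat.eq_zero_or_pos k with hk | hk
    · subst hk
      exact absurd (Subsingleton.elim n 0) hn0
    · exact hk
  have hcomp' : ¬ ((∀ w : Fin 2 → ℂ, MvPolynomial.aeval w (p * q) = 0 →
        ∃ i, MvPolynomial.aeval w (MvPolynomial.pderiv i (p * q)) ≠ 0) ∧
      Irreducible (MvPolynomial.map (algebraMap ℚ ℂ) (p * q))) := by
    rintro ⟨-, hirr⟩
    rw [map_mul] at hirr
    rcases hirr.isUnit_or_isUnit rfl with hu | hu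
    · -- `map p` is not a unit: `p` vanishes at a real point of the oval `O ⟨0, hk⟩`
      obtain ⟨v, hv, -⟩ := hO ⟨0, hk⟩
      have h := hu.map (MvPolynomial.aeval (algebraMap ℝ ℂ ∘ v))
      rw [aeval_map_algebraMap, aeval_algebraMap_apply, hv, map_zero] at h
      exact not_isUnit_zero h
    · -- `1 + x² + y²` is not a unit: it vanishes at `(i, 0)`
      have h := hu.map (MvPolynomial.aeval ![Complex.I, 0])
      have h0 : MvPolynomial.aeval ![Complex.I, 0] (MvPolynomial.map (algebraMap ℚ ℂ) q) = 0 := by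
        rw [aeval_map_algebraMap]
        simp [hq]
      rw [h0] at h
      exact not_isUnit_zero h
  -- transport the oval data along `Z(pq) = Z(p)` and conclude
  have hZ' : IsCompact {v : Fin 2 → ℝ | MvPolynomial.aeval v (p * q) = 0} := hZeq ▸ hZ
  have hO' : ∀ i, ∃ v : Fin 2 → ℝ, MvPolynomial.aeval v (p * q) = 0 ∧
      O i = connectedComponentIn {u : Fin 2 → ℝ | MvPolynomial.aeval u (p * q) = 0} v := by
    intro i
    obtain ⟨v, hv, hOi⟩ := hO i
    exact ⟨v, (hzero v).mpr hv, by rw [hZeq]; exact hOi⟩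
  have hOcov' : ∀ v : Fin 2 → ℝ, MvPolynomial.aeval v (p * q) = 0 → ∃ i, v ∈ O i :=
    fun v hv => hOcov v ((hzero v).mp hv)
  exact hC (p * q) hZ' hsm' hcomp' k O s hO' hOinj hOcov' hsdom hsint n hn0 β e hβ hβ0 hedom
    heint hval

/-- **Conversely, the crux implies the composite stub** (the stub only adds hypotheses).
Together with `OvalSector_of_compositeSector`: `stub_composite`, universally closed, is EQUIVALENT
to the crux `OvalSector`. [cite: KontsevichZagier2001, §1.2 Conjecture 1] -/
theorem compositeSector_of_OvalSector (h : OvalSector) :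
    ∀ (p : MvPolynomial (Fin 2) ℚ), IsCompact {v : Fin 2 → ℝ | MvPolynomial.aeval v p = 0} →
      (∀ v : Fin 2 → ℝ, MvPolynomial.aeval v p = 0 →
        ∃ i, MvPolynomial.aeval v (MvPolynomial.pderiv i p) ≠ 0) →
      ¬ ((∀ w : Fin 2 → ℂ, MvPolynomial.aeval w p = 0 →
          ∃ i, MvPolynomial.aeval w (MvPolynomial.pderiv i p) ≠ 0) ∧
        Irreducible (MvPolynomial.map (algebraMap ℚ ℂ) p)) →
      ∀ (k : ℕ) (O : Fin k → Set (Fin 2 → ℝ)) (s : Fin k → KZ.IntegralRep 2),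
      (∀ i, ∃ v : Fin 2 → ℝ, MvPolynomial.aeval v p = 0 ∧
        O i = connectedComponentIn {u : Fin 2 → ℝ | MvPolynomial.aeval u p = 0} v) →
      Function.Injective O →
      (∀ v : Fin 2 → ℝ, MvPolynomial.aeval v p = 0 → ∃ i, v ∈ O i) →
      (∀ i, (s i).domain =
        {v : Fin 2 → ℝ | v ∉ O i ∧ Bornology.IsBounded (connectedComponentIn (O i)ᶜ v)}) →
      (∀ i, ∀ v ∈ (s i).domain, (s i).integrand v = 1) →
      ∀ (n : Fin k → ℤ), n ≠ 0 → ∀ (β : ℝ) (e : KZ.IntegralRep 2), IsAlgebraic ℚ β → 0 ≤ β →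
      e.domain = {v : Fin 2 → ℝ | v 0 ^ 2 + v 1 ^ 2 < β} →
      (∀ v ∈ e.domain, e.integrand v = 1) →
      ∑ i, (n i : ℝ) * (s i).value = e.value →
      (∑ i, n i • KZ.of (s i)) - KZ.of e ∈ KZ.relations :=
  fun p hZ hsm _ k O s hO hOinj hOcov hsdom hsint n _ β e hβ hβ0 hedom heint hval =>
    h p hZ hsm k O s hO hOinj hOcov hsdom hsint n β e hβ hβ0 hedom heint hval

end Summit.KontsevichZagierPeriods.ComplexOrientations.OvalSector

end
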